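/-
Copyright (c) 2026. All rights reserved.
Released under Apache 2.0 license as described in the file LICENSE.
Authors: HodgeCM publication cell (pub-hodgecm), GR lane, seat GR-2 (`pub-hodgecm-own-hyp34`).
-/
import Literature.NumberTheory.Weil1964.ArchMetaplecticLeviSection
import Literature.NumberTheory.Automorphic.UnitaryGroupSymplecticSplitLevi
import Literature.NumberTheory.Automorphic.UnitaryGroupSymplecticCarriers
import HarnessLib

/-!
# A unitary group over a SPLIT real quadratic algebra lifts homomorphically into Folland's metaplectic group

Topic `NumberTheory/Weil1964`; namespace `Literature.NumberTheory.Weil1964`.  KERNEL ONLY: definitions with bodies and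
theorems; no `def … : Prop` record, no `axiom`, no proof hole.

THE MATHEMATICS ([Kudla1994, §3, the case `E = F ⊕ F`]; [MoeglinVignerasWaldspurger1987, Chap. 2 III.1, type II pairs];
[Folland1989, §4.2 (4.24) and the remark after (4.25)]): over a split quadratic algebra `S = ℝ ⊕ ℝδ`, `δ² = d = s²`,
the unitary group `U(σ, T ⊗ 1)` of a hermitian form with real symmetric Gram matrix `T` is carried by the tree's
embedding `toSymplecticDot : U(σ, H) →* Sp(ℝⁿ × ℝⁿ, polar β_dot)` (`UnitaryGroupSymplecticCarriers`, Darboux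
coordinates) onto a CONJUGATE OF A SUBGROUP OF THE SIEGEL LEVI `{m(a) = (a, a⁻ᵀ)}`: with the split Cayley element
`c = splitCayley` of `UnitaryGroupSymplecticSplitLevi` read in Darboux coordinates (`splitCayleyDot`),
`toSymplecticDot g = splitCayleyDot⁻¹ · m(g₊) · splitCayleyDot` (`toSymplecticDot_eq_conj_levi`), where
`g₊ = g.map evalPlus ∈ GLₙ(ℝ)`.  Since Folland's metaplectic representation restricted to the Levi is an honest
representation (`MpS.leviGLHom` of `ArchMetaplecticLeviSection`), conjugating it by any lift `x ∈ Mp^𝓢(W)` of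
`splitCayleyDot⁻¹` (`MpS.proj_surjective`) gives

  **`archSplitSection x hx : U(σ, H) →* MpS n`**, `g ↦ x · (m(g₊), |det g₊|^{-1/2} f ∘ g₊⁻¹) · x⁻¹`,

a HOMOMORPHIC SECTION of `MpS.proj` over `toSymplecticDot` (`proj_comp_archSplitSection`), independent of the lift `x`
(`archSplitSection_eq_of_proj_eq`), with explicit operators (`archSplitSection_apply_snd`), strongly continuous along
any topology on `U(σ, H)` for which `g ↦ g₊`, `g ↦ g₊⁻¹` are entrywise continuous (`continuous_archSplitSection_snd_apply`),
and it EXISTS (`exists_archSplitSection`).  This is the archimedean Weil section of a unitary group at a REAL PLACE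
SPLIT in `E/F` (and, after realification, at a complex place), the place types that a CM extension never has — the
input `s : G →* MpS σ` of `AdelicMetaplecticArchSection.archLift` for such places in a construction of
[GelbartRogawski1991, Prop. 3.1.1] over a general quadratic extension.

## References
* [Kudla1994] S. S. Kudla, *Splitting metaplectic covers of dual reductive pairs*, Israel J. Math. 87 (1994), §3.
* [MoeglinVignerasWaldspurger1987] C. Mœglin, M.-F. Vignéras, J.-L. Waldspurger, LNM 1291 (1987), Chap. 2 II.2, III.1.
* [Folland1989] G. B. Folland, *Harmonic Analysis in Phase Space* (1989), §4.2 (4.24)–(4.25).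
* [GelbartRogawski1991] S. Gelbart, J. Rogawski, Invent. Math. 105 (1991), §3.1 p. 454, Prop. 3.1.1 p. 455 L1–2.
-/

set_option autoImplicit false

noncomputable section

open Matrix
open Literature.RepresentationTheory.HeisenbergGroup
open Literature.RepresentationTheory.HeisenbergGroup.SymplecticMatrix
open Literature.NumberTheory.Automorphic
open Literature.NumberTheory.Automorphic.UnitaryGroup
open Literature.Analysis.SegalBargmann

namespace Literature.NumberTheory.Weil1964

variable {S : Type*} [CommRing S]
variable {φ : ℝ →+* S} {Ψ : (ℝ × ℝ) ≃+ S} {δ : S} {d : ℝ} (h : IsQuadraticCoordinates φ Ψ δ d)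
variable {s : ℝ} (hs : s * s = d) {e : ℝ} (he : 2 * s * e = 1)
variable (n : Type*) [Fintype n] [DecidableEq n]
variable {T : Matrix n n ℝ} (hTd : IsUnit T.det)
variable {σ : S →+* S} (hσφ : ∀ a, σ (φ a) = φ a) (hσδ : σ δ = -δ) {H : Matrix n n S} (hH : H = T.map φ)

/-! ## §1 The Siegel Levi in Darboux coordinates -/

include hTd in
/-- **the Darboux change of coordinates `θ_T (a, b) = (a, T b)` carries the `β_T`-Levi element `(a, T⁻¹ a⁻ᵀ T)` to
Folland's `m(a) = (a, a⁻ᵀ)`**: `θ_T ∘ leviSp β_T (a) (T⁻¹a⁻ᵀT) ∘ θ_T⁻¹ = proj (MpS.leviGL a)`.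
[cite: Folland1989, §4.2 (4.24)] -/
theorem symplecticGroupCongr_darboux_leviSp (a : GL n ℝ) :
    symplecticGroupCongr _ _ (UnitaryGroup.darboux T hTd) (polar_dot_darboux T hTd)
        (leviSp (Matrix.toLinearMap₂' ℝ T) (glEquiv a) (leviDual T hTd a) (leviDual_compat T hTd a)) =
      MpS.proj (MpS.leviGL a) := by
  refine Subtype.ext (LinearEquiv.ext fun p => ?_)
  rw [coe_symplecticGroupCongr_apply, MpS.coe_proj_leviGL_apply, UnitaryGroup.darboux_symm_apply, coe_leviSp_apply, glEquiv_apply,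
    leviDual_apply, UnitaryGroup.darboux_apply]
  refine Prod.ext rfl ?_
  show T *ᵥ ((T⁻¹ * ((a⁻¹ : GL n ℝ) : Matrix n n ℝ)ᵀ * T) *ᵥ (T⁻¹ *ᵥ p.2)) = ((a⁻¹ : GL n ℝ) : Matrix n n ℝ)ᵀ *ᵥ p.2
  rw [Matrix.mulVec_mulVec, Matrix.mulVec_mulVec,
    show T * (T⁻¹ * ((a⁻¹ : GL n ℝ) : Matrix n n ℝ)ᵀ * T) * T⁻¹ =
      T * (T⁻¹ * ((a⁻¹ : GL n ℝ) : Matrix n n ℝ)ᵀ) * (T * T⁻¹) by simp only [Matrix.mul_assoc],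
    Matrix.mul_nonsing_inv T hTd, Matrix.mul_one, Matrix.mul_nonsing_inv_cancel_left T _ hTd]

/-! ## §2 The unitary group in Darboux coordinates is a conjugate of a subgroup of the Siegel Levi -/

include he hTd in
/-- **the split Cayley element in Darboux coordinates**: `θ_T ∘ splitCayley ∘ θ_T⁻¹ ∈ Sp(ℝⁿ × ℝⁿ, polar β_dot)`.
[cite: MoeglinVignerasWaldspurger1987, Chap. 2 III.1] -/
def splitCayleyDot (hT : T.IsSymm) : symplecticGroup (polar (dotPairing n)) :=
  symplecticGroupCongr _ _ (UnitaryGroup.darboux T hTd) (polar_dot_darboux T hTd) (IsQuadraticCoordinates.splitCayley n T he hT)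

include h hs hσφ hσδ hH in
/-- **`toSymplecticDot g = splitCayleyDot⁻¹ · m(g₊) · splitCayleyDot`** for `g ∈ U(σ, H)`: in Darboux coordinates the
unitary group of the split algebra is conjugate, by the split Cayley element, INTO THE SIEGEL LEVI `m(GLₙ(ℝ))`,
`g ↦ m(g₊)`. [cite: Kudla1994, §3; MoeglinVignerasWaldspurger1987, Chap. 2 III.1] -/
theorem toSymplecticDot_eq_conj_levi (hT : T.IsSymm) (g : unitaryGroupOfForm σ H) :
    h.toSymplecticDot n hT hTd hσφ hσδ hH g =
      (splitCayleyDot he n hTd hT)⁻¹ * MpS.proj (MpS.leviGL (h.plusGL hs n g)) * splitCayleyDot he n hTd hT := by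
  have key := h.splitCayley_conj_toSymplectic hs n hTd he hσφ hσδ hH hT g
  -- `toSymplectic g = c⁻¹ · levi_T(g₊) · c`
  have key' : h.toSymplectic n hT hσφ hσδ hH g =
      (IsQuadraticCoordinates.splitCayley n T he hT)⁻¹ *
        leviSp (Matrix.toLinearMap₂' ℝ T) (glEquiv (h.plusGL hs n g)) (leviDual T hTd (h.plusGL hs n g))
          (leviDual_compat T hTd (h.plusGL hs n g)) * IsQuadraticCoordinates.splitCayley n T he hT := by
    rw [← key]; group
  rw [IsQuadraticCoordinates.toSymplecticDot, MonoidHom.comp_apply, key', map_mul, map_mul, map_inv,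
    symplecticGroupCongr_darboux_leviSp n hTd]
  rfl

/-! ## §3 The section -/

include h hs in
/-- **`archSplitSection x hx : U(σ, H) →* Mp^𝓢(ℝⁿ)`** — for a lift `x ∈ Mp^𝓢(W)` of `splitCayleyDot⁻¹`, the homomorphism
`g ↦ x · leviGL(g₊) · x⁻¹` (the tree's `MpS.leviAlong x (plusGL ∘ incl)`). [cite: Kudla1994, §3; Folland1989, §4.2 (4.24)] -/
def archSplitSection (x : MpS n) : unitaryGroupOfForm σ H →* MpS n :=
  MpS.leviAlong x ((h.plusGL hs n).comp (unitaryGroupOfForm σ H).subtype)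

omit [DecidableEq n] in
/-- formula. [cite: Kudla1994, §3] -/
theorem archSplitSection_apply [DecidableEq n] (x : MpS n) (g : unitaryGroupOfForm σ H) :
    archSplitSection h hs n x g = x * MpS.leviGL (h.plusGL hs n g) * x⁻¹ := rfl

include hσφ hσδ hH in
/-- **`π ∘ archSplitSection x = toSymplecticDot`** whenever `π(x) = splitCayleyDot⁻¹`: a homomorphic SECTION of Folland's
metaplectic extension over the unitary group of the split algebra. [cite: Kudla1994, §3; Folland1989, §4.2 (4.24)] -/
theorem proj_archSplitSection (hT : T.IsSymm) (x : MpS n) (hx : MpS.proj x = (splitCayleyDot he n hTd hT)⁻¹)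
    (g : unitaryGroupOfForm σ H) :
    MpS.proj (archSplitSection h hs n x g) = h.toSymplecticDot n hT hTd hσφ hσδ hH g := by
  rw [archSplitSection, MpS.proj_leviAlong, hx, inv_inv, toSymplecticDot_eq_conj_levi h hs he n hTd hσφ hσδ hH hT g]
  rfl

include hσφ hσδ hH in
/-- the same as homomorphisms. [cite: Kudla1994, §3] -/
theorem proj_comp_archSplitSection (hT : T.IsSymm) (x : MpS n) (hx : MpS.proj x = (splitCayleyDot he n hTd hT)⁻¹) :
    MpS.proj.comp (archSplitSection h hs n x) = h.toSymplecticDot n hT hTd hσφ hσδ hH :=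
  MonoidHom.ext fun g => proj_archSplitSection h hs he n hTd hσφ hσδ hH hT x hx g

/-- **independence of the lift**: two lifts of `splitCayleyDot⁻¹` (indeed any two `x, y` with `π x = π y`) give the
same section. [cite: MoeglinVignerasWaldspurger1987, Chap. 2 II.1 (B)] -/
theorem archSplitSection_eq_of_proj_eq {x y : MpS n} (hxy : MpS.proj x = MpS.proj y) :
    archSplitSection h hs n y = archSplitSection h hs n x (σ := σ) (H := H) :=
  MpS.leviAlong_eq_of_proj_eq hxy _

/-- **the operators**: `S_{archSplitSection x g} f = S_x (|det g₊|^{-1/2} · (S_x⁻¹ f) ∘ g₊⁻¹)` — Folland's Levi operator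
`leviS (glEquiv g₊)` conjugated by `S_x`. [cite: Folland1989, §4.2 (4.24); Kudla1994, §3] -/
theorem archSplitSection_apply_snd (x : MpS n) (g : unitaryGroupOfForm σ H) (f : SchwartzMap (n → ℝ) ℂ) :
    (archSplitSection h hs n x g).1.2 f = x.1.2 (leviS (glEquiv (h.plusGL hs n g)) (x.1.2.symm f)) := rfl

/-- **strong continuity**: for any topology on `U(σ, H)` making `g ↦ g₊⁻¹` entrywise continuous, every orbit map
`g ↦ S_{archSplitSection x g} f` is continuous in `𝓢(ℝⁿ)` (the hypothesis `hsc` of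
`AdelicMetaplecticArchSection.continuous_archLift`). [cite: Folland1989, §4.2 (4.24)] -/
theorem continuous_archSplitSection_snd_apply [TopologicalSpace (unitaryGroupOfForm σ H)] (x : MpS n)
    (hcont : Continuous fun g : unitaryGroupOfForm σ H => (((h.plusGL hs n g)⁻¹ : GL n ℝ) : Matrix n n ℝ))
    (f : SchwartzMap (n → ℝ) ℂ) :
    Continuous fun g : unitaryGroupOfForm σ H => (archSplitSection h hs n x g).1.2 f :=
  MpS.continuous_leviAlong_snd_apply x _ hcont f

/-- continuity of the `π`-orbit maps of the section, for any topology on `U(σ, H)` making `g ↦ g₊` and `g ↦ g₊⁻¹`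
entrywise continuous. [cite: Folland1989, §4.2 (4.24)] -/
theorem continuous_proj_archSplitSection_apply [TopologicalSpace (unitaryGroupOfForm σ H)] (x : MpS n)
    (hcont : Continuous fun g : unitaryGroupOfForm σ H => ((h.plusGL hs n g : GL n ℝ) : Matrix n n ℝ))
    (hcont' : Continuous fun g : unitaryGroupOfForm σ H => (((h.plusGL hs n g)⁻¹ : GL n ℝ) : Matrix n n ℝ))
    (w : (n → ℝ) × (n → ℝ)) :
    Continuous fun g : unitaryGroupOfForm σ H =>
      ((MpS.proj (archSplitSection h hs n x g) : symplecticGroup (polar (dotPairing n))) :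
        ((n → ℝ) × (n → ℝ)) ≃ₗ[ℝ] ((n → ℝ) × (n → ℝ))) w :=
  MpS.continuous_proj_leviAlong_apply x _ hcont hcont' w

include hs he hσφ hσδ hH in
/-- **EXISTENCE**: the unitary group of a split real quadratic algebra admits a homomorphic section into Folland's
metaplectic group over its symplectic embedding (a lift of `splitCayleyDot⁻¹` exists by `MpS.proj_surjective`).
[cite: Kudla1994, §3; Folland1989, §4.2 (4.23)–(4.24)] -/
theorem exists_archSplitSection (hT : T.IsSymm) :
    ∃ sec : unitaryGroupOfForm σ H →* MpS n, MpS.proj.comp sec = h.toSymplecticDot n hT hTd hσφ hσδ hH :=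
  (MpS.proj_surjective (splitCayleyDot he n hTd hT)⁻¹).elim fun x hx =>
    ⟨archSplitSection h hs n x, proj_comp_archSplitSection h hs he n hTd hσφ hσδ hH hT x hx⟩

end Literature.NumberTheory.Weil1964

end
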